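import Summits.ResolutionOfSingularities.ResolutionOfSingularities.Theorems.FrobeniusLadderFInjectiveMacaulayficationFaceFPureOfMonomialPCoeff
import HarnessLib

/-!
# Fedder's test from a monomial alone in its residue class, partial-torus form
# (crux `FInjectiveMacaulayfication`, (H4-gd) calibration tooling)

Support file for crux stmt-ResolutionOfSingularities-15315 (`FrobeniusLadder.FInjectiveMacaulayfication`), chain w45a,
seat res-L1-w45a-stub-4 (res-L1-w45a-plan-1 R8.1: K-P / `…PConeOffVertex`). [OURS · L1 W4.5a] — NOT a statement of the
manuscript [claim: Hironaka2017]; AI-written, weaker than expert review.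

stub-3's `FaceFPureOfMonomialPCoeff.faceFPure_of_monomial_pcoeff` (p496035) proves Fedder's test
`(F ⊗ K)^(p-1) ∉ ((yᵢ − bᵢ)^p)` at every TORUS point `b` (all `bᵢ ≠ 0`) from a monomial `γ₀` of `F^(p-1)` that is alone in
its residue class mod `p` (given as an explicit expansion). This file is the PARTIAL-TORUS twin needed off the vertex of a cone
whose bad locus is the vertex but whose singular locus is not: the same conclusion at every `b` with `bᵢ ≠ 0` only for the
coordinates `i` with `γ₀ᵢ ≥ p` (the `p`-coefficient of the class of `γ₀` is the single monomial `u·y^(γ₀ div p)`, which does not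
see the other coordinates), and with the singleton hypothesis stated on the SUPPORT of `F^(p-1)` (`hsing`) and the coefficient
(`hu`) rather than on an explicit expansion — so that a consumer can discharge `hsing` by weight counting when `F` is weighted
homogeneous, without expanding `F^(p-1)`.

`fedder_of_singleton_support` — the criterion.

No definitions, no named facts; glue over `FaceFPureOfMonomialPCoeff.fedder_of_aeval_expand_ne_zero`.
[cite: Fedder1983, Prop. 1.7]
-/

-- single-problem summit: the doubled namespace component is forced
set_option linter.dupNamespace false

noncomputable section

namespace Summit.ResolutionOfSingularities.ResolutionOfSingularities.Theorems.FInjectiveMacaulayfication.FedderSingletonSupport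

open MvPolynomial
open Summit.ResolutionOfSingularities.ResolutionOfSingularities.Theorems.FInjectiveMacaulayfication

/-- **Fedder's test from a monomial alone in its class, partial-torus form.** If `γ₀` lies in the support of `F^(p-1)` and
every other exponent of the support differs from `γ₀` modulo `p` in some coordinate, then `(F ⊗ K)^(p-1) ∉ ((yᵢ − bᵢ)^p)`
at every `K`-point `b` with `bᵢ ≠ 0` for all `i` with `γ₀ᵢ ≥ p` (the `p`-coefficient of the class of `γ₀` is the single
monomial `u·y^(γ₀ div p)`, non-zero at such `b`). (Adapted from `FaceFPureOfMonomialPCoeff.faceFPure_of_monomial_pcoeff`,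
which asks `bᵢ ≠ 0` for all `i`.) [cite: Fedder1983, Prop. 1.7] -/
-- adapted from FaceFPureOfMonomialPCoeff.faceFPure_of_monomial_pcoeff (stub-3)
theorem fedder_of_singleton_support (p : ℕ) [Fact p.Prime] {k : Type} [Field k] [CharP k p] {n : ℕ}
    (F : MvPolynomial (Fin n) k) (γ₀ : Fin n →₀ ℕ) (hu : coeff γ₀ (F ^ (p - 1)) ≠ 0)
    (hsing : ∀ γ ∈ (F ^ (p - 1)).support, (∀ i : Fin n, γ i % p = γ₀ i % p) → γ = γ₀)
    {K : Type} [Field K] [Algebra k K] (b : Fin n → K) (hb : ∀ i : Fin n, p ≤ γ₀ i → b i ≠ 0) :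
    (MvPolynomial.map (algebraMap k K) F) ^ (p - 1) ∉
      Ideal.span (Set.range fun i : Fin n => (MvPolynomial.X i - MvPolynomial.C (b i)) ^ p) := by
  classical
  have hp : 0 < p := (Fact.out : p.Prime).pos
  set G := F ^ (p - 1) with hG
  -- class and quotient of an exponent
  let cls : (Fin n →₀ ℕ) → (Fin n → Fin p) := fun γ j => ⟨γ j % p, Nat.mod_lt _ hp⟩
  let quo : (Fin n →₀ ℕ) → (Fin n →₀ ℕ) := fun γ => Finsupp.equivFunOnFinite.symm fun j => γ j / p
  have hmon : ∀ γ : Fin n →₀ ℕ, MvPolynomial.expand p (MvPolynomial.monomial (quo γ) (1 : k)) *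
      MvPolynomial.monomial (Finsupp.equivFunOnFinite.symm fun j => ((cls γ j : ℕ))) 1 = MvPolynomial.monomial γ 1 :=
    fun γ => FaceFPureOfMonomialPCoeff.expand_monomial_mul_monomial_cls p hp γ
  -- the `p`-coefficient polynomials, read off the support
  let c : (Fin n → Fin p) → MvPolynomial (Fin n) k := fun α =>
    ∑ γ ∈ G.support with cls γ = α, MvPolynomial.C (coeff γ G) * MvPolynomial.monomial (quo γ) 1
  have hdec : F ^ (p - 1) = ∑ α : Fin n → Fin p, MvPolynomial.expand p (c α) *
      MvPolynomial.monomial (Finsupp.equivFunOnFinite.symm fun j => ((α j : ℕ))) 1 := by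
    have h1 : ∀ α : Fin n → Fin p, MvPolynomial.expand p (c α) *
        MvPolynomial.monomial (Finsupp.equivFunOnFinite.symm fun j => ((α j : ℕ))) (1 : k) =
        ∑ γ ∈ G.support with cls γ = α, MvPolynomial.C (coeff γ G) * MvPolynomial.monomial γ 1 := by
      intro α
      simp only [c, map_sum, Finset.sum_mul]
      refine Finset.sum_congr rfl fun γ hγ => ?_
      rw [Finset.mem_filter] at hγ
      rw [map_mul, MvPolynomial.expand_C, mul_assoc, ← hγ.2, hmon]
    simp only [h1]
    rw [← hG, Finset.sum_fiberwise G.support cls fun γ => MvPolynomial.C (coeff γ G) * MvPolynomial.monomial γ (1 : k)]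
    conv_lhs => rw [G.as_sum]
    refine Finset.sum_congr rfl fun γ _ => ?_
    rw [MvPolynomial.C_mul_monomial, mul_one]
  refine FaceFPureOfMonomialPCoeff.fedder_of_aeval_expand_ne_zero p F c hdec b ⟨cls γ₀, ?_⟩
  -- the class of `γ₀` is `{γ₀}`: `ψ_p(c_{cls γ₀})(b) = u · b^(p • quo γ₀) ≠ 0`
  have hγ₀ : γ₀ ∈ G.support := mem_support_iff.mpr hu
  have hfilter : (G.support.filter fun γ => cls γ = cls γ₀) = {γ₀} := by
    refine Finset.eq_singleton_iff_unique_mem.mpr ⟨Finset.mem_filter.mpr ⟨hγ₀, rfl⟩, fun γ hγ => ?_⟩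
    rw [Finset.mem_filter] at hγ
    exact hsing γ hγ.1 fun i => by simpa [cls] using congrArg (fun f : Fin n → Fin p => ((f i : ℕ))) hγ.2
  have hc0 : c (cls γ₀) = MvPolynomial.C (coeff γ₀ G) * MvPolynomial.monomial (quo γ₀) 1 := by
    change ∑ γ ∈ G.support with cls γ = cls γ₀, _ = _
    rw [hfilter, Finset.sum_singleton]
  rw [hc0, map_mul, MvPolynomial.expand_C, MvPolynomial.expand_monomial, map_mul, MvPolynomial.aeval_C,
    MvPolynomial.aeval_monomial, map_one, one_mul]
  refine mul_ne_zero ((map_ne_zero_iff _ (algebraMap k K).injective).mpr hu) ?_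
  rw [Finsupp.prod]
  refine Finset.prod_ne_zero_iff.mpr fun i hi => pow_ne_zero _ (hb i ?_)
  rw [Finsupp.mem_support_iff, Finsupp.smul_apply, smul_eq_mul] at hi
  have hq : (quo γ₀) i = γ₀ i / p := by simp [quo]
  rw [hq] at hi
  by_contra hlt
  exact hi (by rw [Nat.div_eq_of_lt (not_le.mp hlt), mul_zero])

end Summit.ResolutionOfSingularities.ResolutionOfSingularities.Theorems.FInjectiveMacaulayfication.FedderSingletonSupport

end
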